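import Literature.Analysis.FluidPDE.DuchonRobertLocalBalance
import Literature.Analysis.FluidPDE.CoarseGrainingEstimates
import Literature.Analysis.FunctionSpaces.MinkowskiIntegral
import Mathlib.MeasureTheory.Function.LpSeminorm.CompareExp
import HarnessLib

/-!
# `Lʳ` bounds for the three mollified increment quantities of De Rosa–Isett's §5.1
# (quadratic increment average, pressure–velocity remainder, Duchon–Robert flux)

Analysis/FluidPDE support file (theorem-only; serves the discharge of
`Literature.Barriers.AnomalousDissipation.DeRosaIsett2024_s51_finalBound`, the a-priori bound
(final_bound_D) of De Rosa–Isett, ARMA 248 (2024) = arXiv:2212.08176, §5.1). The symmetric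
Duchon–Robert commutator identity of the tree
(`Torus.two_mul_energyFlux_add_energyFlux_mollified_eq`, `DuchonRobertSymmetricCommutator`)
expresses `2(𝓔(ψ) + 𝓔(ψ ⋆ₓ K))`, `K = k_ε = Torus.kernel ε`, through three slice quantities of the
velocity `u : T^d → ℝ^d` and pressure `p : T^d → ℝ`:

* the quadratic increment average `ω_K(u) = |u|² + |u|² ⋆ K − 2⟪u, u ⋆ K⟫`,
* the Constantin–E–Titi pressure–velocity remainder
  `𝒞_K(p,u) = (pu) ⋆ K + p u − p (u ⋆ K) − (p ⋆ K) u`,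
* the Duchon–Robert flux `𝒟_K(u) = Torus.kernelFlux K u = ∫ ⟪∇K(z), δ_z u⟫ |δ_z u|² dz`.

This file rewrites the first two as kernel averages of increments,
`ω_K(u)(x) = ∫ K(y) |u(x−y) − u(x)|² dy` (`Torus.quadIncrement_eq_integral`),
`𝒞_K(p,u)(x) = ∫ K(y) (p(x−y) − p(x)) (u(x−y) − u(x)) dy` (`Torus.pressureRemainder_eq_integral`),
and proves the `Lʳ(T^d)` bounds used in op. cit. §5.1 ((CET_commutator), (est_II), (est_III),
Prop. 3.1 for the cubic term) in Besov form, by Minkowski–Jensen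
(`FunctionSpaces.eLpNorm_integral_smul_le_mul`, `FunctionSpaces.eLpNorm_integral_le_lintegral_eLpNorm`)
and the translation modulus `‖δ_y f‖_{Lᵖ} ≤ [f]_{B^θ_{p,∞}} ε^θ` for `‖y‖ ≤ ε`:

* `Torus.eLpNorm_quadIncrement_le` — `‖ω_K(u)‖_{Lˢ} ≤ ([u]_{B^θ_{2s,∞}} ε^θ)²` (`1 ≤ s < ∞`);
* `Torus.eLpNorm_pressureRemainder_le` — `‖𝒞_K(p,u)‖_{Lʳ} ≤ [p]_{B^θ_{a,∞}} [u]_{B^θ_{b,∞}} ε^{2θ}`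
  for `1/a + 1/b = 1/r`, `1 ≤ r < ∞`;
* `Torus.eLpNorm_kernelFlux_le` — `‖𝒟_K(u)‖_{Lʳ} ≤ (C₁/ε) ([u]_{B^θ_{3r,∞}} ε^θ)³`,
  `C₁ = Torus.gradProfileMass d` (`∫‖∇k_ε‖ = C₁/ε`), `1 ≤ r < ∞`.

## Mathlib search

Mathlib (this pin): Hölder for scalar products `eLpNorm_smul_le_mul_eLpNorm` (`ENNReal.HolderTriple`),
`eLpNorm_norm_rpow`, `integral_inner`, `quasiMeasurePreserving_add`; no mollifier commutator
estimates (tree: `CoarseGrainingEstimates` has the `(2,2,1)` cumulant bounds and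
`TorusMollifierEstimates` the Minkowski–Jensen lemma and `eLpNorm_comp_sub_sub_le_eBesovSupSeminorm`).

## References

* L. De Rosa, P. Isett, Arch. Ration. Mech. Anal. 248 (2024), Paper No. 11 = arXiv:2212.08176,
  §5.1 ((est_II), (est_III)), Prop. 3.1, (CET_commutator). [DeRosaIsett2024]
* P. Constantin, W. E, E. S. Titi, Comm. Math. Phys. 165 (1994), (6)–(11). [ConstantinETiti1994]
* J. Duchon, R. Robert, Nonlinearity 13 (2000) 249–255, Prop. 1–2. [DuchonRobert2000]
-/

noncomputable section

open MeasureTheory TopologicalSpace Set Function Filter Metric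
open _root_.Topology
open scoped ENNReal NNReal Convolution InnerProductSpace RealInnerProductSpace

namespace Literature.Analysis.FluidPDE.Torus

open Literature.Analysis.FunctionSpaces

variable {d : Type*} [Fintype d] {ε : ℝ}

/-! ## The quadratic increment average `ω_K(u)` -/

section Quad

/-- **The quadratic increment average as a kernel average**: for `u ∈ L²(T^d; ℝ^d)` and the torus
mollifier `K = k_ε` (`0 < ε ≤ 1/4`), at every point
`|u(x)|² + (|u|² ⋆ K)(x) − 2⟪u(x), (u ⋆ K)(x)⟫ = ∫ K(y) |u(x−y) − u(x)|² dy`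
(expand the square; `∫ K = 1`). [cite: DeRosaIsett2024, §5.1] -/
theorem quadIncrement_eq_integral {u : UnitAddTorus d → EuclideanSpace ℝ d} (hu : MemLp u 2 volume)
    (hε : 0 < ε) (hε' : ε ≤ 1 / 4) (x : UnitAddTorus d) :
    ‖u x‖ ^ 2 + ((fun y => ‖u y‖ ^ 2) ⋆ FunctionSpaces.Torus.kernel ε) x -
        2 * ⟪u x, vecConv u (FunctionSpaces.Torus.kernel ε) x⟫ =
      ∫ y, FunctionSpaces.Torus.kernel ε y * ‖u (x - y) - u x‖ ^ 2 := by
  set K := FunctionSpaces.Torus.kernel (d := d) ε with hK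
  have hKc : Continuous K := FunctionSpaces.Torus.continuous_kernel hε hε'
  have hu1 : Integrable u volume := hu.integrable one_le_two
  have hu2 : Integrable (fun y => ‖u y‖ ^ 2) volume := hu.integrable_norm_pow two_ne_zero
  have hi1 : Integrable (fun y => K y • u (x - y)) volume :=
    FunctionSpaces.Torus.integrable_kernel_smul_comp_sub hu1 hKc x
  have hi2 : Integrable (fun y => K y * ‖u (x - y)‖ ^ 2) volume := by
    have h := FunctionSpaces.Torus.integrable_kernel_smul_comp_sub hu2 hKc x
    simpa [smul_eq_mul] using h
  have hi3 : Integrable (fun y => K y * (2 * ⟪u (x - y), u x⟫)) volume := by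
    have h : Integrable (fun y => 2 * ⟪K y • u (x - y), u x⟫) volume := (hi1.inner_const (u x)).const_mul 2
    refine h.congr (Eventually.of_forall fun y => ?_)
    simp only [inner_smul_left, RCLike.conj_to_real]
    ring
  have hi4 : Integrable (fun y => K y * ‖u x‖ ^ 2) volume := hKc.integrable_unitAddTorus.mul_const _
  have hexp : ∀ y, K y * ‖u (x - y) - u x‖ ^ 2 =
      K y * ‖u (x - y)‖ ^ 2 - K y * (2 * ⟪u (x - y), u x⟫) + K y * ‖u x‖ ^ 2 := by
    intro y
    rw [@norm_sub_sq_real]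
    ring
  simp_rw [hexp]
  have hi23 : Integrable (fun y => K y * ‖u (x - y)‖ ^ 2 - K y * (2 * ⟪u (x - y), u x⟫)) volume :=
    hi2.sub hi3
  rw [integral_add hi23 hi4, integral_sub hi2 hi3, integral_mul_const,
    FunctionSpaces.Torus.integral_kernel hε hε', one_mul]
  have e1 : ∫ y, K y * ‖u (x - y)‖ ^ 2 = ((fun y => ‖u y‖ ^ 2) ⋆ K) x :=
    (convolution_kernel_apply_eq_integral (fun y => ‖u y‖ ^ 2) ε x).symm
  have e2 : ∫ y, K y * (2 * ⟪u (x - y), u x⟫) = 2 * ⟪u x, vecConv u K x⟫ := by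
    have h1 : ∫ y, K y * (2 * ⟪u (x - y), u x⟫) = 2 * ∫ y, ⟪u x, K y • u (x - y)⟫ := by
      rw [← integral_const_mul]
      refine integral_congr_ae (Eventually.of_forall fun y => ?_)
      show K y * (2 * ⟪u (x - y), u x⟫) = 2 * ⟪u x, K y • u (x - y)⟫
      rw [real_inner_comm, inner_smul_right]
      ring
    rw [h1, integral_inner hi1 (u x), ← vecConv_kernel_apply_eq_integral hu1 hε hε' x]
  rw [e1, e2]
  ring

/-- **`Lˢ` bound for the quadratic increment average** (De Rosa–Isett 2024, §5.1, the role of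
(CET_commutator) for `tr R_ε`; here for `ω_K`): for `1 ≤ s < ∞`, `θ > 0` and `u ∈ L²` with finite
`B^θ_{2s,∞}` seminorm, `‖ω_K(u)‖_{Lˢ} ≤ ([u]_{B^θ_{2s,∞}} ε^θ)²` — Minkowski–Jensen with the unit-mass
kernel and `‖ |δ_{-y}u|² ‖_{Lˢ} = ‖δ_{-y}u‖²_{L^{2s}} ≤ ([u] ε^θ)²` for `‖y‖ < ε`. [cite: DeRosaIsett2024, §5.1 (est_III)] -/
theorem eLpNorm_quadIncrement_le {u : UnitAddTorus d → EuclideanSpace ℝ d} (hu : MemLp u 2 volume)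
    (hε : 0 < ε) (hε' : ε ≤ 1 / 4) {s : ℝ≥0∞} (hs : 1 ≤ s) (hs' : s ≠ ⊤) {θ : ℝ} (hθ : 0 < θ) :
    eLpNorm (fun x => ‖u x‖ ^ 2 + ((fun y => ‖u y‖ ^ 2) ⋆ FunctionSpaces.Torus.kernel ε) x -
        2 * ⟪u x, vecConv u (FunctionSpaces.Torus.kernel ε) x⟫) s volume ≤
      (eBesovSupSeminorm θ (2 * s) u volume * ENNReal.ofReal (ε ^ θ)) ^ 2 := by
  set K := FunctionSpaces.Torus.kernel (d := d) ε with hK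
  have hfun : (fun x => ‖u x‖ ^ 2 + ((fun y => ‖u y‖ ^ 2) ⋆ K) x - 2 * ⟪u x, vecConv u K x⟫) =
      fun x => ∫ y, K y • ‖u (x - y) - u x‖ ^ 2 := by
    funext x
    rw [quadIncrement_eq_integral hu hε hε' x]
    rfl
  rw [hfun]
  have hΦ : AEStronglyMeasurable (uncurry fun x y : UnitAddTorus d => ‖u (x - y) - u x‖ ^ 2)
      ((volume : Measure (UnitAddTorus d)).prod volume) :=
    ((FunctionSpaces.Torus.aestronglyMeasurable_comp_sub_sub hu.1).norm.pow 2)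
  refine (FunctionSpaces.eLpNorm_integral_smul_le_mul
    (FunctionSpaces.Torus.continuous_kernel hε hε').aestronglyMeasurable hΦ hs hs'
    (A := (eBesovSupSeminorm θ (2 * s) u volume * ENNReal.ofReal (ε ^ θ)) ^ 2)
    (Eventually.of_forall fun y hy => ?_)).trans ?_
  · have hyε : ‖y‖ ≤ ε := (mem_ball_zero_iff.1 (FunctionSpaces.Torus.support_kernel_subset hε hy)).le
    have h1 : eLpNorm (fun x => ‖u (x - y) - u x‖ ^ (2 : ℝ)) s volume =
        eLpNorm (fun x => u (x - y) - u x) (s * ENNReal.ofReal 2) volume ^ (2 : ℝ) :=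
      eLpNorm_norm_rpow _ two_pos
    have h2 : (fun x => ‖u (x - y) - u x‖ ^ 2) = fun x => ‖u (x - y) - u x‖ ^ (2 : ℝ) := by
      funext x
      norm_cast
    have h3 : s * ENNReal.ofReal 2 = 2 * s := by
      rw [ENNReal.ofReal_ofNat, mul_comm]
    rw [h2, h1, h3]
    have h4 := FunctionSpaces.Torus.eLpNorm_comp_sub_sub_le_eBesovSupSeminorm (θ := u) hθ
      (p := 2 * s) hyε
    calc eLpNorm (fun x => u (x - y) - u x) (2 * s) volume ^ (2 : ℝ)
        ≤ (eBesovSupSeminorm θ (2 * s) u volume * ENNReal.ofReal (ε ^ θ)) ^ (2 : ℝ) := by gcongr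
      _ = (eBesovSupSeminorm θ (2 * s) u volume * ENNReal.ofReal (ε ^ θ)) ^ 2 := by norm_cast
  · rw [FunctionSpaces.Torus.lintegral_enorm_kernel hε hε', one_mul]

end Quad

/-! ## The pressure–velocity remainder `𝒞_K(p,u)` -/

section Remainder

/-- **The Constantin–E–Titi pressure–velocity remainder as a kernel average**: for `p u ∈ L¹`,
`p ∈ L¹`, `u ∈ L¹` and `K = k_ε` (`0 < ε ≤ 1/4`), at every point
`((pu) ⋆ K)(x) + p(x)u(x) − p(x)(u ⋆ K)(x) − (p ⋆ K)(x) u(x) = ∫ K(y) (p(x−y) − p(x)) (u(x−y) − u(x)) dy`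
(`∫ K = 1`; Constantin–E–Titi 1994, (10)). [cite: ConstantinETiti1994, (10)] -/
theorem pressureRemainder_eq_integral {p : UnitAddTorus d → ℝ} {u : UnitAddTorus d → EuclideanSpace ℝ d}
    (hp : Integrable p volume) (hu : Integrable u volume)
    (hpu : Integrable (fun y => p y • u y) volume) (hε : 0 < ε) (hε' : ε ≤ 1 / 4) (x : UnitAddTorus d) :
    vecConv (fun y => p y • u y) (FunctionSpaces.Torus.kernel ε) x + p x • u x -
        p x • vecConv u (FunctionSpaces.Torus.kernel ε) x -
        (p ⋆ FunctionSpaces.Torus.kernel ε) x • u x =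
      ∫ y, FunctionSpaces.Torus.kernel ε y • ((p (x - y) - p x) • (u (x - y) - u x)) := by
  set K := FunctionSpaces.Torus.kernel (d := d) ε with hK
  have hKc : Continuous K := FunctionSpaces.Torus.continuous_kernel hε hε'
  have hi1 : Integrable (fun y => K y • (p (x - y) • u (x - y))) volume :=
    FunctionSpaces.Torus.integrable_kernel_smul_comp_sub hpu hKc x
  have hi2 : Integrable (fun y => K y • (p (x - y) • u x)) volume := by
    have h : Integrable (fun y => (K y * p (x - y)) • u x) volume := by
      have h1 := FunctionSpaces.Torus.integrable_kernel_smul_comp_sub hp hKc x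
      simp only [smul_eq_mul] at h1
      exact h1.smul_const (u x)
    refine h.congr (Eventually.of_forall fun y => ?_)
    show (K y * p (x - y)) • u x = K y • (p (x - y) • u x)
    rw [mul_smul]
  have hi3 : Integrable (fun y => K y • (p x • u (x - y))) volume := by
    have h := (FunctionSpaces.Torus.integrable_kernel_smul_comp_sub hu hKc x).smul (p x)
    refine h.congr (Eventually.of_forall fun y => ?_)
    show p x • (K y • u (x - y)) = K y • (p x • u (x - y))
    rw [smul_comm]
  have hi4 : Integrable (fun y => K y • (p x • u x)) volume :=
    hKc.integrable_unitAddTorus.smul_const _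
  have hexp : ∀ y, K y • ((p (x - y) - p x) • (u (x - y) - u x)) =
      K y • (p (x - y) • u (x - y)) - K y • (p (x - y) • u x) - K y • (p x • u (x - y)) +
        K y • (p x • u x) := by
    intro y
    simp only [sub_smul, smul_sub]
    abel
  simp_rw [hexp]
  have hi12 : Integrable (fun y => K y • (p (x - y) • u (x - y)) - K y • (p (x - y) • u x)) volume :=
    hi1.sub hi2
  have hi123 : Integrable (fun y => K y • (p (x - y) • u (x - y)) - K y • (p (x - y) • u x) -
      K y • (p x • u (x - y))) volume := hi12.sub hi3
  rw [integral_add hi123 hi4, integral_sub hi12 hi3, integral_sub hi1 hi2]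
  have e1 : ∫ y, K y • (p (x - y) • u (x - y)) = vecConv (fun y => p y • u y) K x :=
    (vecConv_kernel_apply_eq_integral hpu hε hε' x).symm
  have e2 : ∫ y, K y • (p (x - y) • u x) = (p ⋆ K) x • u x := by
    have h1 : (fun y => K y • (p (x - y) • u x)) = fun y => (K y * p (x - y)) • u x := by
      funext y
      rw [mul_smul]
    rw [h1, integral_smul_const, convolution_kernel_apply_eq_integral]
  have e3 : ∫ y, K y • (p x • u (x - y)) = p x • vecConv u K x := by
    have h1 : (fun y => K y • (p x • u (x - y))) = fun y => p x • (K y • u (x - y)) := by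
      funext y
      rw [smul_comm]
    rw [h1, integral_smul, vecConv_kernel_apply_eq_integral hu hε hε' x]
  have e4 : ∫ y, K y • (p x • u x) = p x • u x := by
    rw [integral_smul_const, FunctionSpaces.Torus.integral_kernel hε hε', one_smul]
  rw [e1, e2, e3, e4]
  abel

/-- **`Lʳ` bound for the pressure–velocity remainder** (De Rosa–Isett 2024, §5.1 (est_II);
Constantin–E–Titi 1994, (10)–(11)): for `1 ≤ r < ∞`, `1/a + 1/b = 1/r`, `θ > 0`, and
`p ∈ L¹ ∩ B^θ_{a,∞}`, `u ∈ L¹ ∩ B^θ_{b,∞}` with `p u ∈ L¹`,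
`‖𝒞_K(p,u)‖_{Lʳ} ≤ [p]_{B^θ_{a,∞}} [u]_{B^θ_{b,∞}} ε^{2θ}` (Minkowski–Jensen with the unit-mass kernel,
Hölder `Lᵃ · Lᵇ ⊂ Lʳ` on each increment product). [cite: DeRosaIsett2024, §5.1 (est_II)] -/
theorem eLpNorm_pressureRemainder_le {p : UnitAddTorus d → ℝ} {u : UnitAddTorus d → EuclideanSpace ℝ d}
    (hp : Integrable p volume) (hu : Integrable u volume)
    (hpu : Integrable (fun y => p y • u y) volume) (hε : 0 < ε) (hε' : ε ≤ 1 / 4)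
    {a b r : ℝ≥0∞} (hr : 1 ≤ r) (hr' : r ≠ ⊤) [ENNReal.HolderTriple a b r] {θ : ℝ} (hθ : 0 < θ) :
    eLpNorm (fun x => vecConv (fun y => p y • u y) (FunctionSpaces.Torus.kernel ε) x + p x • u x -
        p x • vecConv u (FunctionSpaces.Torus.kernel ε) x -
        (p ⋆ FunctionSpaces.Torus.kernel ε) x • u x) r volume ≤
      eBesovSupSeminorm θ a p volume * eBesovSupSeminorm θ b u volume * ENNReal.ofReal (ε ^ θ) ^ 2 := by
  set K := FunctionSpaces.Torus.kernel (d := d) ε with hK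
  have hfun : (fun x => vecConv (fun y => p y • u y) K x + p x • u x - p x • vecConv u K x -
      (p ⋆ K) x • u x) = fun x => ∫ y, K y • ((p (x - y) - p x) • (u (x - y) - u x)) := by
    funext x
    exact pressureRemainder_eq_integral hp hu hpu hε hε' x
  rw [hfun]
  have hpm : AEStronglyMeasurable (uncurry fun x y : UnitAddTorus d => p (x - y) - p x)
      ((volume : Measure (UnitAddTorus d)).prod volume) :=
    FunctionSpaces.Torus.aestronglyMeasurable_comp_sub_sub hp.aestronglyMeasurable
  have hum : AEStronglyMeasurable (uncurry fun x y : UnitAddTorus d => u (x - y) - u x)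
      ((volume : Measure (UnitAddTorus d)).prod volume) :=
    FunctionSpaces.Torus.aestronglyMeasurable_comp_sub_sub hu.aestronglyMeasurable
  have hΦ : AEStronglyMeasurable (uncurry fun x y : UnitAddTorus d => (p (x - y) - p x) • (u (x - y) - u x))
      ((volume : Measure (UnitAddTorus d)).prod volume) := hpm.smul hum
  refine (FunctionSpaces.eLpNorm_integral_smul_le_mul
    (FunctionSpaces.Torus.continuous_kernel hε hε').aestronglyMeasurable hΦ hr hr'
    (A := eBesovSupSeminorm θ a p volume * eBesovSupSeminorm θ b u volume * ENNReal.ofReal (ε ^ θ) ^ 2)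
    (Eventually.of_forall fun y hy => ?_)).trans ?_
  · have hyε : ‖y‖ ≤ ε := (mem_ball_zero_iff.1 (FunctionSpaces.Torus.support_kernel_subset hε hy)).le
    have hpy : AEStronglyMeasurable (fun x => p (x - y) - p x) volume :=
      (hp.aestronglyMeasurable.comp_quasiMeasurePreserving
        (measurePreserving_sub_right volume y).quasiMeasurePreserving).sub
        hp.aestronglyMeasurable
    have huy : AEStronglyMeasurable (fun x => u (x - y) - u x) volume :=
      (hu.aestronglyMeasurable.comp_quasiMeasurePreserving
        (measurePreserving_sub_right volume y).quasiMeasurePreserving).sub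
        hu.aestronglyMeasurable
    have hH : eLpNorm ((fun x => p (x - y) - p x) • fun x => u (x - y) - u x) r volume ≤
        eLpNorm (fun x => p (x - y) - p x) a volume * eLpNorm (fun x => u (x - y) - u x) b volume :=
      eLpNorm_smul_le_mul_eLpNorm huy hpy
    have hP := FunctionSpaces.Torus.eLpNorm_comp_sub_sub_le_eBesovSupSeminorm (θ := p) hθ (p := a) hyε
    have hU := FunctionSpaces.Torus.eLpNorm_comp_sub_sub_le_eBesovSupSeminorm (θ := u) hθ (p := b) hyε
    calc eLpNorm (fun x => (p (x - y) - p x) • (u (x - y) - u x)) r volume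
        = eLpNorm ((fun x => p (x - y) - p x) • fun x => u (x - y) - u x) r volume := rfl
      _ ≤ eLpNorm (fun x => p (x - y) - p x) a volume * eLpNorm (fun x => u (x - y) - u x) b volume := hH
      _ ≤ (eBesovSupSeminorm θ a p volume * ENNReal.ofReal (ε ^ θ)) *
            (eBesovSupSeminorm θ b u volume * ENNReal.ofReal (ε ^ θ)) := mul_le_mul' hP hU
      _ = eBesovSupSeminorm θ a p volume * eBesovSupSeminorm θ b u volume * ENNReal.ofReal (ε ^ θ) ^ 2 := by
            ring
  · rw [FunctionSpaces.Torus.lintegral_enorm_kernel hε hε', one_mul]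

end Remainder

/-! ## The Duchon–Robert flux `𝒟_K(u)` -/

section Flux

/-- `‖⟪a, b⟫ |b|²‖ ≤ ‖a‖ ‖b‖³` (Cauchy–Schwarz). [folklore] -/
theorem norm_inner_mul_norm_sq_le (a b : EuclideanSpace ℝ d) : ‖⟪a, b⟫ * ‖b‖ ^ 2‖ ≤ ‖a‖ * ‖b‖ ^ 3 := by
  rw [norm_mul, norm_pow, norm_norm]
  calc ‖⟪a, b⟫‖ * ‖b‖ ^ 2 ≤ (‖a‖ * ‖b‖) * ‖b‖ ^ 2 := by
        gcongr
        exact norm_inner_le_norm a b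
    _ = ‖a‖ * ‖b‖ ^ 3 := by ring

/-- **`Lʳ` bound for the Duchon–Robert flux through the torus mollifier** (De Rosa–Isett 2024,
Prop. 3.1 / §5.1 (eul_Rey_err), (est_D_first_easy) in the symmetric Duchon–Robert form;
Duchon–Robert 2000, (11)): for `1 ≤ r < ∞`, `θ > 0` and an a.e.-strongly measurable `u` with
finite `B^θ_{3r,∞}` seminorm,
`‖𝒟_{k_ε}(u)‖_{Lʳ} ≤ (C₁/ε) ([u]_{B^θ_{3r,∞}} ε^θ)³`, `C₁ = Torus.gradProfileMass d`:
Minkowski's integral inequality in `z`, `|⟪∇K(z), δ_z u⟫|δ_z u|²| ≤ |∇K(z)| |δ_z u|³`,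
`‖ |δ_z u|³ ‖_{Lʳ} = ‖δ_z u‖³_{L^{3r}} ≤ ([u] ε^θ)³` on the support `{|z| ≤ ε}` of `∇K`, and
`∫ |∇k_ε| = C₁/ε`. [cite: DeRosaIsett2024, Prop. 3.1 and §5.1] [cite: DuchonRobert2000, (11)] -/
theorem eLpNorm_kernelFlux_le {u : UnitAddTorus d → EuclideanSpace ℝ d}
    (hu : AEStronglyMeasurable u volume) (hε : 0 < ε) (hε' : ε ≤ 1 / 4)
    {r : ℝ≥0∞} (hr : 1 ≤ r) (hr' : r ≠ ⊤) {θ : ℝ} (hθ : 0 < θ) :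
    eLpNorm (kernelFlux (FunctionSpaces.Torus.kernel ε) u) r volume ≤
      ENNReal.ofReal (ε⁻¹ * FunctionSpaces.Torus.gradProfileMass d) *
        (eBesovSupSeminorm θ (3 * r) u volume * ENNReal.ofReal (ε ^ θ)) ^ 3 := by
  set K := FunctionSpaces.Torus.kernel (d := d) ε with hK
  set A : ℝ≥0∞ := eBesovSupSeminorm θ (3 * r) u volume * ENNReal.ofReal (ε ^ θ) with hA
  set F : UnitAddTorus d → UnitAddTorus d → ℝ := fun x z =>
    ⟪FunctionSpaces.Torus.gradient K z, u (x + z) - u x⟫ * ‖u (x + z) - u x‖ ^ 2 with hF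
  have hfun : kernelFlux K u = fun x => ∫ z, F x z := by
    funext x
    rfl
  -- joint measurability of the integrand
  have hinc : AEStronglyMeasurable (uncurry fun x z : UnitAddTorus d => u (x + z) - u x)
      ((volume : Measure (UnitAddTorus d)).prod volume) :=
    (hu.comp_quasiMeasurePreserving (quasiMeasurePreserving_add _ _)).sub hu.comp_fst
  have hgK : Continuous (FunctionSpaces.Torus.gradient K) :=
    FunctionSpaces.Torus.continuous_gradient_kernel hε hε'
  have hFm : AEStronglyMeasurable (uncurry F) ((volume : Measure (UnitAddTorus d)).prod volume) := by
    have h1 : AEStronglyMeasurable (fun q : UnitAddTorus d × UnitAddTorus d =>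
        FunctionSpaces.Torus.gradient K q.2) ((volume : Measure (UnitAddTorus d)).prod volume) :=
      (hgK.comp continuous_snd).aestronglyMeasurable
    exact (h1.inner hinc).mul (hinc.norm.pow 2)
  rw [hfun]
  refine (FunctionSpaces.eLpNorm_integral_le_lintegral_eLpNorm hFm hr hr').trans ?_
  -- slice bound in `z`
  have hslice : ∀ z, eLpNorm (fun x => F x z) r volume ≤ ‖FunctionSpaces.Torus.gradient K z‖ₑ * A ^ 3 := by
    intro z
    by_cases hz : FunctionSpaces.Torus.gradient K z = 0
    · have h0 : (fun x => F x z) = fun _ => 0 := by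
        funext x
        simp [hF, hz]
      rw [h0, eLpNorm_zero']
      exact zero_le
    have hzε : ‖z‖ ≤ ε := FunctionSpaces.Torus.norm_le_of_gradient_kernel_ne_zero hε hε' hz
    by_cases hz0 : z = 0
    · subst hz0
      have h0 : (fun x => F x 0) = fun _ => 0 := by
        funext x
        simp [hF]
      rw [h0, eLpNorm_zero']
      exact zero_le
    have h1 : eLpNorm (fun x => F x z) r volume ≤
        eLpNorm (fun x => ‖FunctionSpaces.Torus.gradient K z‖ * ‖u (x + z) - u x‖ ^ 3) r volume :=
      eLpNorm_mono_real fun x => norm_inner_mul_norm_sq_le _ _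
    have h2 : eLpNorm (fun x => ‖FunctionSpaces.Torus.gradient K z‖ * ‖u (x + z) - u x‖ ^ 3) r volume =
        ‖FunctionSpaces.Torus.gradient K z‖ₑ * eLpNorm (fun x => ‖u (x + z) - u x‖ ^ 3) r volume := by
      have e : (fun x => ‖FunctionSpaces.Torus.gradient K z‖ * ‖u (x + z) - u x‖ ^ 3) =
          ‖FunctionSpaces.Torus.gradient K z‖ • fun x => ‖u (x + z) - u x‖ ^ 3 := by
        funext x
        simp [smul_eq_mul]
      rw [e, eLpNorm_const_smul, enorm_norm]
    have h3 : eLpNorm (fun x => ‖u (x + z) - u x‖ ^ 3) r volume =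
        eLpNorm (fun x => u (x + z) - u x) (3 * r) volume ^ 3 := by
      have e1 : (fun x => ‖u (x + z) - u x‖ ^ 3) = fun x => ‖u (x + z) - u x‖ ^ (3 : ℝ) := by
        funext x
        norm_cast
      have e2 := eLpNorm_norm_rpow (fun x => u (x + z) - u x) (q := (3 : ℝ)) (p := r) (μ := volume)
        three_pos
      have e3 : r * ENNReal.ofReal 3 = 3 * r := by rw [ENNReal.ofReal_ofNat, mul_comm]
      rw [e1, e2, e3]
      norm_cast
    have h4 : eLpNorm (fun x => u (x + z) - u x) (3 * r) volume ≤ A := by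
      refine (eLpNorm_sub_le_eBesovSupSeminorm_mul (s := θ) (p := 3 * r) (f := u) (μ := volume) hz0).trans ?_
      rw [hA]
      gcongr _ * ENNReal.ofReal ?_
      exact Real.rpow_le_rpow (norm_nonneg _) hzε hθ.le
    calc eLpNorm (fun x => F x z) r volume
        ≤ ‖FunctionSpaces.Torus.gradient K z‖ₑ * eLpNorm (fun x => ‖u (x + z) - u x‖ ^ 3) r volume :=
          h1.trans_eq h2
      _ = ‖FunctionSpaces.Torus.gradient K z‖ₑ * eLpNorm (fun x => u (x + z) - u x) (3 * r) volume ^ 3 := by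
          rw [h3]
      _ ≤ ‖FunctionSpaces.Torus.gradient K z‖ₑ * A ^ 3 := by gcongr
  calc ∫⁻ z, eLpNorm (fun x => F x z) r volume
      ≤ ∫⁻ z, ‖FunctionSpaces.Torus.gradient K z‖ₑ * A ^ 3 := lintegral_mono hslice
    _ = (∫⁻ z, ‖FunctionSpaces.Torus.gradient K z‖ₑ) * A ^ 3 := lintegral_mul_const _ hgK.measurable.enorm
    _ = ENNReal.ofReal (ε⁻¹ * FunctionSpaces.Torus.gradProfileMass d) * A ^ 3 := by
        rw [FunctionSpaces.Torus.lintegral_enorm_gradient_kernel hε hε']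

end Flux

end Literature.Analysis.FluidPDE.Torus

end
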